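import Summits.AtomisticToContinuum.HydrodynamicLimit.Theorems.LambertianContactSwapCollisionMomentBoundRung0
import Summits.AtomisticToContinuum.HydrodynamicLimit.Theorems.LambertianContactSwapContactAngleEquidistributionCentring
import HarnessLib

/-!
# The angular Gaussian cubic flux moment is finite
# (stub `stub_eqFluxMoment` of line `Sketch` v5, crux `LambertianContactSwap.ContactAngleEquidistribution`,
# stmt-AtomisticToContinuum-12097; lead `prover-line-stmt-AtomisticToContinuum-12097-c2-0`)

WHAT. For every temperature `θ > 0` the ANGULAR CUBIC FLUX MOMENT of two independent Maxwellian
velocities is finite: there is `K = K(θ)` with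
`∫ dv ∫ dw ∫_{S²} dσ(ω) (⟪ω, w − v⟫)₊ M_θ(v) M_θ(w) ‖v − w‖² ≤ K`, where `M_θ = localMaxwellian 1 θ 0`
is the centred unit-density Maxwellian on `V3 = ℝ³`, `dv, dw` are Lebesgue and `dσ = volume.toSphere` is
the surface measure of the unit sphere (all integrals are lower Lebesgue integrals of `ℝ≥0∞`-valued
integrands, `(·)₊` being `ENNReal.ofReal`).  After the Campbell formula and the integration of the
spectators, this is the `N`-independent velocity factor of the equilibrium comparison flux in the
assembly of the equilibrium crux.

HOW. Bound, do not compute: on the unit sphere `⟪ω, w − v⟫ ≤ ‖ω‖ ‖w − v‖ = ‖w − v‖` (Cauchy–Schwarz) and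
`‖v − w‖² ≤ 1 + ‖v − w‖³`, so the `ω`-integral is at most
`σ(S²) · M_θ(v) M_θ(w) · ‖w − v‖ (1 + ‖v − w‖³)` with `σ(S²) = volume.toSphere univ < ∞`
(`IsFiniteMeasure volume.toSphere`).  The Maxwellian weights turn Lebesgue measure into the Gaussian
probability `gaussMeasure 0 θ` (`withDensity_localMaxwellian_eq_gaussMeasure` and
`lintegral_withDensity_eq_lintegral_mul_non_measurable`), Tonelli (`lintegral_prod`) turns the iterated
integral into the product one, and the flux-weighted Gaussian cubic moment
`∫ ‖w − v‖ (1 + ‖v − w‖³) dγ dγ` is finite (`lintegral_cubicFluxMoment_ne_top`, quartic Gaussian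
moments).  `K` is the real part of the resulting finite bound.

References: C. Cercignani, R. Illner, M. Pulvirenti, *The Mathematical Theory of Dilute Gases*,
Springer (1994), §3.2 (Maxwellian moments), App. 4.A (the collision flux measure).
-/

noncomputable section

open MeasureTheory Filter Set Topology ProbabilityTheory
open scoped ENNReal BigOperators Classical RealInnerProductSpace

namespace Summit.AtomisticToContinuum.HydrodynamicLimit.Theorems.ContactAngleEquidistributionSketch

open Literature.Analysis.FluidPDE Literature.MathematicalPhysics.KineticTheory
open Summit.AtomisticToContinuum.HydrodynamicLimit.Theorems.LambertianContactSwapCollisionMomentBound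

/-- The pointwise bound on the angular flux integrand: for `ω` on the unit sphere,
`(⟪ω, w − v⟫)₊ · (M v M w) · ‖v − w‖² ≤ M v · M w · ‖w − v‖ (1 + ‖v − w‖³)` in `ℝ≥0∞`
(Cauchy–Schwarz with `‖ω‖ = 1` and `r² ≤ 1 + r³`). [folklore] -/
theorem angularFluxIntegrand_le {θ : ℝ} (hθ : 0 < θ) (v w : V3) (ω : Metric.sphere (0 : V3) 1) :
    ENNReal.ofReal ⟪((ω : V3)), w - v⟫ *
        ENNReal.ofReal (localMaxwellian 1 θ 0 v * localMaxwellian 1 θ 0 w) *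
        ENNReal.ofReal (‖v - w‖ ^ 2) ≤
      ENNReal.ofReal (localMaxwellian 1 θ 0 v) * (ENNReal.ofReal (localMaxwellian 1 θ 0 w) *
        (ENNReal.ofReal ‖w - v‖ * ENNReal.ofReal (1 + ‖v - w‖ ^ 3))) := by
  have hin : ⟪((ω : V3)), w - v⟫ ≤ ‖w - v‖ := by
    have h := real_inner_le_norm (ω : V3) (w - v)
    rwa [norm_eq_of_mem_sphere ω, one_mul] at h
  have hsq : ‖v - w‖ ^ 2 ≤ 1 + ‖v - w‖ ^ 3 := by
    -- `r² ≤ 1 + r³` for `r ≥ 0`: `1 + r³ − r² = r (r − 1)² + (r² − r + 1)`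
    have hr : 0 ≤ ‖v - w‖ := norm_nonneg _
    nlinarith [mul_nonneg hr (sq_nonneg (‖v - w‖ - 1)), sq_nonneg (‖v - w‖ - 1 / 2)]
  rw [ENNReal.ofReal_mul (localMaxwellian_nonneg zero_le_one hθ.le (0 : V3) v)]
  calc ENNReal.ofReal ⟪((ω : V3)), w - v⟫ *
        (ENNReal.ofReal (localMaxwellian 1 θ 0 v) * ENNReal.ofReal (localMaxwellian 1 θ 0 w)) *
        ENNReal.ofReal (‖v - w‖ ^ 2)
      ≤ ENNReal.ofReal ‖w - v‖ *
        (ENNReal.ofReal (localMaxwellian 1 θ 0 v) * ENNReal.ofReal (localMaxwellian 1 θ 0 w)) *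
        ENNReal.ofReal (1 + ‖v - w‖ ^ 3) :=
        mul_le_mul' (mul_le_mul' (ENNReal.ofReal_le_ofReal hin) le_rfl) (ENNReal.ofReal_le_ofReal hsq)
    _ = ENNReal.ofReal (localMaxwellian 1 θ 0 v) * (ENNReal.ofReal (localMaxwellian 1 θ 0 w) *
        (ENNReal.ofReal ‖w - v‖ * ENNReal.ofReal (1 + ‖v - w‖ ^ 3))) := by ring

/-- Integration against the Maxwellian weight `M_θ(w) dw` is integration against the Gaussian probability
`gaussMeasure 0 θ`, for an ARBITRARY `ℝ≥0∞`-valued integrand (the density is measurable and finite).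
[folklore] -/
theorem lintegral_ofReal_localMaxwellian_mul {θ : ℝ} (hθ : 0 < θ) (g : V3 → ℝ≥0∞) :
    ∫⁻ w, ENNReal.ofReal (localMaxwellian 1 θ 0 w) * g w = ∫⁻ w, g w ∂(gaussMeasure (0 : V3) θ) := by
  rw [← withDensity_localMaxwellian_eq_gaussMeasure hθ (0 : V3),
    lintegral_withDensity_eq_lintegral_mul_non_measurable _
      (continuous_localMaxwellian 1 θ (0 : V3)).measurable.ennreal_ofReal
      (Eventually.of_forall fun _ => ENNReal.ofReal_lt_top) g]
  rfl

/-- **Registered sub-goal `stub_eqFluxMoment`** (line `Sketch` v5, crux ContactAngleEquidistribution,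
stmt-AtomisticToContinuum-12097): the ANGULAR CUBIC FLUX MOMENT of two independent Maxwellian velocities is
finite, `∫ dv ∫ dw ∫_{S²} dω (⟪ω, w − v⟫)₊ M_θ(v) M_θ(w) ‖v − w‖² ≤ K(θ) < ∞`: bound `(⟪ω, w − v⟫)₊ ≤ ‖w − v‖`
on the unit sphere (finite surface measure) and `‖v − w‖² ≤ 1 + ‖v − w‖³`, pass to the Gaussian product law
(`withDensity_localMaxwellian_eq_gaussMeasure`, Tonelli) and use the finite flux-weighted Gaussian cubic
moment `lintegral_cubicFluxMoment_ne_top`. [folklore] -/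
theorem stub_eqFluxMoment {θ : ℝ} (hθ : 0 < θ) :
    ∃ K : ℝ, ∫⁻ v : V3, ∫⁻ w : V3, ∫⁻ ω : Metric.sphere (0 : V3) 1,
        ENNReal.ofReal ⟪((ω : V3)), w - v⟫ * ENNReal.ofReal (localMaxwellian 1 θ 0 v * localMaxwellian 1 θ 0 w) *
          ENNReal.ofReal (‖v - w‖ ^ 2) ∂(volume : Measure V3).toSphere ≤ ENNReal.ofReal K := by
  -- the finite total surface measure of the unit sphere and the finite Gaussian cubic flux moment
  have hS : (volume : Measure V3).toSphere univ ≠ ⊤ := measure_ne_top _ _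
  have hI := lintegral_cubicFluxMoment_ne_top (0 : V3) θ
  have hGm : Measurable fun p : V3 × V3 =>
      ENNReal.ofReal ‖p.2 - p.1‖ * ENNReal.ofReal (1 + ‖p.1 - p.2‖ ^ 3) := by
    fun_prop
  -- the `ω`-integral, bounded pointwise
  have hω : ∀ v w : V3, ∫⁻ ω : Metric.sphere (0 : V3) 1,
      ENNReal.ofReal ⟪((ω : V3)), w - v⟫ *
        ENNReal.ofReal (localMaxwellian 1 θ 0 v * localMaxwellian 1 θ 0 w) *
        ENNReal.ofReal (‖v - w‖ ^ 2) ∂(volume : Measure V3).toSphere ≤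
      ENNReal.ofReal (localMaxwellian 1 θ 0 v) * (ENNReal.ofReal (localMaxwellian 1 θ 0 w) *
        ((volume : Measure V3).toSphere univ *
          (ENNReal.ofReal ‖w - v‖ * ENNReal.ofReal (1 + ‖v - w‖ ^ 3)))) := by
    intro v w
    calc ∫⁻ ω : Metric.sphere (0 : V3) 1, ENNReal.ofReal ⟪((ω : V3)), w - v⟫ *
            ENNReal.ofReal (localMaxwellian 1 θ 0 v * localMaxwellian 1 θ 0 w) *
            ENNReal.ofReal (‖v - w‖ ^ 2) ∂(volume : Measure V3).toSphere
        ≤ ∫⁻ _ω : Metric.sphere (0 : V3) 1, ENNReal.ofReal (localMaxwellian 1 θ 0 v) *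
            (ENNReal.ofReal (localMaxwellian 1 θ 0 w) *
              (ENNReal.ofReal ‖w - v‖ * ENNReal.ofReal (1 + ‖v - w‖ ^ 3))) ∂(volume : Measure V3).toSphere :=
          lintegral_mono fun ω => angularFluxIntegrand_le hθ v w ω
      _ = ENNReal.ofReal (localMaxwellian 1 θ 0 v) * (ENNReal.ofReal (localMaxwellian 1 θ 0 w) *
            (ENNReal.ofReal ‖w - v‖ * ENNReal.ofReal (1 + ‖v - w‖ ^ 3))) *
            (volume : Measure V3).toSphere univ := lintegral_const _
      _ = _ := by ring
  -- Maxwellian weights → Gaussian product law → the finite cubic flux moment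
  have hmain : ∫⁻ v : V3, ∫⁻ w : V3, ∫⁻ ω : Metric.sphere (0 : V3) 1,
      ENNReal.ofReal ⟪((ω : V3)), w - v⟫ *
        ENNReal.ofReal (localMaxwellian 1 θ 0 v * localMaxwellian 1 θ 0 w) *
        ENNReal.ofReal (‖v - w‖ ^ 2) ∂(volume : Measure V3).toSphere ≤
      (volume : Measure V3).toSphere univ *
        ∫⁻ p, ENNReal.ofReal ‖p.2 - p.1‖ * ENNReal.ofReal (1 + ‖p.1 - p.2‖ ^ 3)
          ∂((gaussMeasure (0 : V3) θ).prod (gaussMeasure (0 : V3) θ)) := by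
    calc ∫⁻ v : V3, ∫⁻ w : V3, ∫⁻ ω : Metric.sphere (0 : V3) 1,
          ENNReal.ofReal ⟪((ω : V3)), w - v⟫ *
            ENNReal.ofReal (localMaxwellian 1 θ 0 v * localMaxwellian 1 θ 0 w) *
            ENNReal.ofReal (‖v - w‖ ^ 2) ∂(volume : Measure V3).toSphere
        ≤ ∫⁻ v : V3, ∫⁻ w : V3, ENNReal.ofReal (localMaxwellian 1 θ 0 v) *
            (ENNReal.ofReal (localMaxwellian 1 θ 0 w) * ((volume : Measure V3).toSphere univ *
              (ENNReal.ofReal ‖w - v‖ * ENNReal.ofReal (1 + ‖v - w‖ ^ 3)))) :=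
          lintegral_mono fun v => lintegral_mono fun w => hω v w
      _ = ∫⁻ v : V3, ENNReal.ofReal (localMaxwellian 1 θ 0 v) *
            ∫⁻ w : V3, (volume : Measure V3).toSphere univ *
              (ENNReal.ofReal ‖w - v‖ * ENNReal.ofReal (1 + ‖v - w‖ ^ 3)) ∂(gaussMeasure (0 : V3) θ) :=
          lintegral_congr fun v => by
            rw [lintegral_const_mul' _ _ ENNReal.ofReal_ne_top, lintegral_ofReal_localMaxwellian_mul hθ]
      _ = ∫⁻ v : V3, ∫⁻ w : V3, (volume : Measure V3).toSphere univ *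
              (ENNReal.ofReal ‖w - v‖ * ENNReal.ofReal (1 + ‖v - w‖ ^ 3)) ∂(gaussMeasure (0 : V3) θ)
            ∂(gaussMeasure (0 : V3) θ) := lintegral_ofReal_localMaxwellian_mul hθ _
      _ = ∫⁻ p, (volume : Measure V3).toSphere univ *
            (ENNReal.ofReal ‖p.2 - p.1‖ * ENNReal.ofReal (1 + ‖p.1 - p.2‖ ^ 3))
            ∂((gaussMeasure (0 : V3) θ).prod (gaussMeasure (0 : V3) θ)) :=
          (lintegral_prod _ (measurable_const.mul hGm).aemeasurable).symm
      _ = _ := lintegral_const_mul' _ _ hS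
  refine ⟨((volume : Measure V3).toSphere univ *
    ∫⁻ p, ENNReal.ofReal ‖p.2 - p.1‖ * ENNReal.ofReal (1 + ‖p.1 - p.2‖ ^ 3)
      ∂((gaussMeasure (0 : V3) θ).prod (gaussMeasure (0 : V3) θ))).toReal, ?_⟩
  rwa [ENNReal.ofReal_toReal (ENNReal.mul_ne_top hS hI)]

end Summit.AtomisticToContinuum.HydrodynamicLimit.Theorems.ContactAngleEquidistributionSketch

end
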